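import Literature.Geometry.GeometricMeasureTheory.CurrentsIntegralBound
import Literature.Geometry.GeometricMeasureTheory.CurrentsPushforward
import Literature.Geometry.GeometricMeasureTheory.RectifiableNormalize
import Mathlib.MeasureTheory.Function.ContinuousMapDense
import Mathlib.Analysis.Normed.Operator.Extend

/-!
# Currents representable by integration: the extension to `L¹(‖T‖)` and the restriction `T ⌞ A`

Federer 4.1.5 / 4.1.7: a current `T ∈ 𝒟_m(Ω)` whose variation measure `‖T‖` is a Radon measure
over `Ω` is **representable by integration**, `T(φ) = ∫ ⟨φ, T⃗⟩ d‖T‖`; such `T` extends to all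
bounded Borel (indeed all `‖T‖`-integrable) forms, and for a Borel set `A` one defines the
restriction **`T ⌞ A`**, `(T ⌞ A)(φ) = ∫_A ⟨φ, T⃗⟩ d‖T‖`. This file builds this for the currents of
`Currents.lean` (finite-dimensional `E`, open `Ω ⊆ E`):

* `Current.IsRepresentable T` — `‖T‖(K) < ∞` for every compact `K ⊆ Ω`; finite mass suffices
  (`isRepresentable_of_mass_ne_top`), currents `μ ∧ F` with `F` locally integrable and currents
  of integration `[W, θ, ξ]` with admissible data are representable
  (`isRepresentable_vectorCurrent`, `IsRectifiableData.isRepresentable`), sums/negatives too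
  (`variation_add_le : ‖S + T‖ ≤ ‖S‖ + ‖T‖`).
* `Current.IsRepresentable.integrable_testForm`, `abs_apply_le_lintegral` — test forms are
  `‖T‖`-integrable and `|T(φ)| ≤ ∫ ‖φ‖ d‖T‖` (from `CurrentsIntegralBound.lean`);
  `apply_eq_of_ae_eq`.
* `Current.IsRepresentable.toL1 : 𝒟^m(Ω) →ₗ L¹(‖T‖; ⋀ᵐ E^*)` and **`denseRange_toL1`** — test
  forms are dense in `L¹(‖T‖)` (truncation to an open set with compact closure in `Ω`, Mathlib's
  `Integrable.exists_hasCompactSupport_lintegral_sub_le` for the finite — hence regular —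
  restricted measure, a smooth cutoff inside `Ω`, and mollification with support control).
* `Current.IsRepresentable.extend : L¹(‖T‖; ⋀ᵐ E^*) →L[ℝ] ℝ` — **the unique continuous extension
  `T̄`** with `T̄ [φ] = T(φ)` (`extend_toL1`), `|T̄ f| ≤ ‖f‖₁` (`abs_extend_le`), uniqueness
  (`eq_extend`); Mathlib's `LinearMap.extendOfNorm`.
* `Current.IsRepresentable.restrictSet hT A hA : 𝒟_m(Ω)` — **`T ⌞ A`**, `(T ⌞ A)(φ) = T̄ [1_A φ]`,
  a current (continuity on `𝒟_K` from `|·| ≤ ‖T‖(K) sup ‖φ‖`), with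
  `|(T ⌞ A)(φ)| ≤ ∫_A ‖φ‖ d‖T‖`, `T ⌞ E = T`, `T ⌞ ∅ = 0`, additivity on disjoint sets,
  `T ⌞ A + T ⌞ Aᶜ = T`, dependence on `A` only up to `‖T‖`-null sets, `(T ⌞ A)(φ) = T(φ)` if
  `spt φ ⊆ A` and `= 0` if `spt φ ∩ A = ∅`, **`‖T ⌞ A‖(U) ≤ ‖T‖(A ∩ U)`**, `𝐌(T ⌞ A) ≤ ‖T‖(A)`,
  `‖T ⌞ A‖ ≤ ‖T‖`, and `T ⌞ A` is again representable.

* `restrictSet_vectorCurrent : (μ ∧ F) ⌞ A = (μ ⌞ A) ∧ F` (limit of `T(ψₙ) = ∫ F(ψₙ) dμ` along test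
  forms `[ψₙ] → [1_A φ]` in `L¹(‖T‖)`), `IsRectifiableData.restrictSet_eq : [W, θ, ξ] ⌞ A =
  [W ∩ A, θ, ξ]`, `IsRectifiableData.inter`, and hence **restrictions of locally rectifiable
  currents to Borel sets are locally rectifiable** (`isLocallyRectifiable_restrictSet`).

Not here: the polar decomposition `T = ‖T‖ ∧ T⃗`, `‖T ⌞ A‖ = ‖T‖ ⌞ A` with equality, slicing
(4.2.1).

## References

* H. Federer, *Geometric Measure Theory*, Springer 1969, 4.1.5, 4.1.7 [Federer1969].
-/

noncomputable section

open scoped Distributions ENNReal NNReal Topology ContDiff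
open MeasureTheory TopologicalSpace Set Filter Metric Function

namespace Literature.Geometry.GeometricMeasureTheory

set_option maxSynthPendingDepth 3

/-! ### Currents representable by integration -/

section Representable

variable {E : Type*} [NormedAddCommGroup E] [NormedSpace ℝ E] [FiniteDimensional ℝ E]
  [MeasurableSpace E] [BorelSpace E] {Ω : Opens E} {m : ℕ}

/-- **Currents representable by integration** [Federer1969, 4.1.5, 4.1.7]: `‖T‖` is a Radon
measure over `Ω`, i.e. finite on the compact subsets of `Ω` ("If `𝐌(T ⌞ K) < ∞` for every compact
`K ⊆ U` … `T` is representable by integration"). [cite: Federer1969, 4.1.7] -/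
def Current.IsRepresentable (T : Current Ω m) : Prop :=
  ∀ K : Set E, IsCompact K → K ⊆ (Ω : Set E) → T.variation K ≠ ⊤

/-- Currents of finite mass are representable. [cite: Federer1969, 4.1.7] -/
theorem Current.isRepresentable_of_mass_ne_top (T : Current Ω m) (h : T.mass ≠ ⊤) :
    T.IsRepresentable := fun K _ _ => ne_top_of_le_ne_top h (T.variation_le_mass K)

/-- `0` is representable. [folklore] -/
theorem Current.isRepresentable_zero : (0 : Current Ω m).IsRepresentable := fun K _ _ => by
  simp

/-- `-T` is representable iff `T` is. [folklore] -/
theorem Current.IsRepresentable.neg {T : Current Ω m} (h : T.IsRepresentable) :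
    (-T).IsRepresentable := fun K hK hKΩ => by
  rw [Current.variation_neg]; exact h K hK hKΩ

omit [FiniteDimensional ℝ E] [MeasurableSpace E] [BorelSpace E] in
/-- `‖S + T‖(U) ≤ ‖S‖(U) + ‖T‖(U)` on every set. [cite: Federer1969, 4.1.7] -/
theorem Current.variationOn_add_le (S T : Current Ω m) (U : Set E) :
    (S + T).variationOn U ≤ S.variationOn U + T.variationOn U := by
  refine iSup_le fun φ => iSup_le fun hφ => iSup_le fun hU => ?_
  rw [show (S + T) φ = S φ + T φ from rfl]
  exact ENNReal.ofReal_add_le.trans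
    (add_le_add (S.ofReal_apply_le_variationOn hφ hU) (T.ofReal_apply_le_variationOn hφ hU))

/-- `‖T‖(A)` as an infimum over the subtype of admissible open sets. [folklore] -/
theorem Current.variation_eq_iInf_subtype (T : Current Ω m) {A : Set E} (hA : MeasurableSet A) :
    T.variation A = ⨅ U : {U : Set E // IsOpen U ∧ A ∩ (Ω : Set E) ⊆ U}, T.variationOn U := by
  rw [T.variation_eq_iInf_isOpen hA]
  apply le_antisymm
  · exact le_iInf fun U => iInf_le_of_le U.1 (iInf_le_of_le U.2.1 (iInf_le_of_le U.2.2 le_rfl))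
  · exact le_iInf fun U => le_iInf fun hU => le_iInf fun hAU =>
      iInf_le_of_le ⟨U, hU, hAU⟩ le_rfl

/-- `‖S + T‖ ≤ ‖S‖ + ‖T‖` as measures. [cite: Federer1969, 4.1.7] -/
theorem Current.variation_add_le (S T : Current Ω m) :
    (S + T).variation ≤ S.variation + T.variation := by
  refine Measure.le_intro fun A hA _ => ?_
  rw [Measure.add_apply, (S + T).variation_eq_iInf_subtype hA, S.variation_eq_iInf_subtype hA,
    T.variation_eq_iInf_subtype hA]
  haveI : Nonempty {U : Set E // IsOpen U ∧ A ∩ (Ω : Set E) ⊆ U} :=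
    ⟨⟨univ, isOpen_univ, subset_univ _⟩⟩
  rw [ENNReal.iInf_add]
  refine le_iInf fun U₁ => ?_
  rw [ENNReal.add_iInf]
  refine le_iInf fun U₂ => ?_
  refine (iInf_le _ ⟨U₁.1 ∩ U₂.1, U₁.2.1.inter U₂.2.1, subset_inter U₁.2.2 U₂.2.2⟩).trans ?_
  exact (Current.variationOn_add_le S T _).trans (add_le_add
    (S.variationOn_mono inter_subset_left) (T.variationOn_mono inter_subset_right))

/-- Representable currents form a subgroup: sums. [cite: Federer1969, 4.1.7] -/
theorem Current.IsRepresentable.add {S T : Current Ω m} (hS : S.IsRepresentable)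
    (hT : T.IsRepresentable) : (S + T).IsRepresentable := fun K hK hKΩ =>
  ne_top_of_le_ne_top (ENNReal.add_ne_top.2 ⟨hS K hK hKΩ, hT K hK hKΩ⟩)
    ((Current.variation_add_le S T) K)

/-- Representable currents form a subgroup: differences. [cite: Federer1969, 4.1.7] -/
theorem Current.IsRepresentable.sub {S T : Current Ω m} (hS : S.IsRepresentable)
    (hT : T.IsRepresentable) : (S - T).IsRepresentable := by
  rw [sub_eq_add_neg]; exact hS.add hT.neg

end Representable

section RepresentableFD

variable {V : Type*} [NormedAddCommGroup V] [InnerProductSpace ℝ V] [FiniteDimensional ℝ V]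
  [MeasurableSpace V] [BorelSpace V] {Ω : Opens V} {m : ℕ}

/-- **`μ ∧ F` is representable** for `F` locally `μ`-integrable on `Ω` ("`‖μ ∧ η‖ = μ ⌞ ‖η‖`").
[cite: Federer1969, 4.1.7] -/
theorem isRepresentable_vectorCurrent {μ : Measure V} {F : V → Multivector V m}
    (hF : LocallyIntegrableOn F (Ω : Set V) μ) :
    (vectorCurrent μ F : Current Ω m).IsRepresentable := by
  intro K hK hKΩ
  rw [variation_vectorCurrent_eq hF, Measure.restrict_apply hK.isClosed.measurableSet,
    inter_eq_self_of_subset_left hKΩ, withDensity_apply _ hK.isClosed.measurableSet]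
  exact ((hF.integrableOn_compact_subset hKΩ hK).2).ne

/-- **Currents of integration with admissible data are representable** (their variation
`|θ| 𝓗ᵐ ⌞ W` is Radon over `Ω`). [cite: Federer1969, 4.1.28] -/
theorem IsRectifiableData.isRepresentable {W : Set V} {θ : V → ℤ} {ξ : V → Fin m → V}
    (h : IsRectifiableData Ω m W θ ξ) :
    (currentOfIntegration W θ ξ : Current Ω m).IsRepresentable :=
  isRepresentable_vectorCurrent h.2.2.2.1

end RepresentableFD

/-! ### Test forms are `‖T‖`-integrable; the integral bound for representable currents -/

section Integrable

variable {E : Type*} [NormedAddCommGroup E] [NormedSpace ℝ E] [FiniteDimensional ℝ E]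
  [MeasurableSpace E] [BorelSpace E] {Ω : Opens E} {m : ℕ}

/-- A compact subset of `Ω` has an open neighbourhood with compact closure in `Ω`, of finite
`‖T‖`-measure when `T` is representable. [folklore] -/
theorem Current.IsRepresentable.exists_isOpen_superset {T : Current Ω m} (hT : T.IsRepresentable)
    {K : Set E} (hK : IsCompact K) (hKΩ : K ⊆ (Ω : Set E)) :
    ∃ U : Set E, IsOpen U ∧ K ⊆ U ∧ IsCompact (closure U) ∧ closure U ⊆ (Ω : Set E) ∧
      T.variation U ≠ ⊤ := by
  obtain ⟨L, hL, hKL, hLΩ⟩ := exists_compact_between hK Ω.isOpen hKΩ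
  have hcl : closure (interior L) ⊆ L := closure_minimal interior_subset hL.isClosed
  exact ⟨interior L, isOpen_interior, hKL, hL.of_isClosed_subset isClosed_closure hcl,
    hcl.trans hLΩ, ne_top_of_le_ne_top (hT L hL hLΩ) (measure_mono interior_subset)⟩

/-- **Test forms are `‖T‖`-integrable** for representable `T`. [cite: Federer1969, 4.1.7] -/
theorem Current.IsRepresentable.integrable_testForm {T : Current Ω m} (hT : T.IsRepresentable)
    (φ : TestForm Ω m) : Integrable ⇑φ T.variation := by
  obtain ⟨M, hM, hφM⟩ := TestForm.exists_pos_forall_norm_le φ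
  have hK : IsCompact (tsupport ⇑φ) := φ.hasCompactSupport
  refine (integrableOn_iff_integrable_of_support_subset (subset_tsupport ⇑φ)).1 ?_
  exact Measure.integrableOn_of_bounded (hT _ hK φ.tsupport_subset)
    φ.continuous.aestronglyMeasurable (Eventually.of_forall fun x => hφM x)

/-- `∫ ‖φ‖ d‖T‖ < ∞` for representable `T`. [cite: Federer1969, 4.1.7] -/
theorem Current.IsRepresentable.lintegral_enorm_ne_top {T : Current Ω m} (hT : T.IsRepresentable)
    (φ : TestForm Ω m) : ∫⁻ x, ‖φ x‖ₑ ∂T.variation ≠ ⊤ :=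
  (hT.integrable_testForm φ).2.ne

/-- **`T(φ) ≤ ∫ ‖φ‖ d‖T‖` for representable `T`.** [cite: Federer1969, 4.1.7] -/
theorem Current.IsRepresentable.ofReal_apply_le_lintegral {T : Current Ω m}
    (hT : T.IsRepresentable) (φ : TestForm Ω m) :
    ENNReal.ofReal (T φ) ≤ ∫⁻ x, ‖φ x‖ₑ ∂T.variation := by
  obtain ⟨U, hU, hKU, -, -, hfin⟩ := hT.exists_isOpen_superset φ.hasCompactSupport φ.tsupport_subset
  exact T.ofReal_apply_le_lintegral φ hU hKU hfin

/-- **`|T(φ)| ≤ ∫ ‖φ‖ d‖T‖` for representable `T`.** [cite: Federer1969, 4.1.7] -/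
theorem Current.IsRepresentable.abs_apply_le_lintegral {T : Current Ω m}
    (hT : T.IsRepresentable) (φ : TestForm Ω m) :
    |T φ| ≤ (∫⁻ x, ‖φ x‖ₑ ∂T.variation).toReal := by
  obtain ⟨U, hU, hKU, -, -, hfin⟩ := hT.exists_isOpen_superset φ.hasCompactSupport φ.tsupport_subset
  exact T.abs_apply_le_lintegral φ hU hKU hfin (hT.lintegral_enorm_ne_top φ)

/-- `T(φ) = T(φ')` when `φ = φ'` `‖T‖`-a.e. (representable `T`). [cite: Federer1969, 4.1.7] -/
theorem Current.IsRepresentable.apply_eq_of_ae_eq {T : Current Ω m} (hT : T.IsRepresentable)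
    {φ φ' : TestForm Ω m} (h : ⇑φ =ᵐ[T.variation] ⇑φ') : T φ = T φ' := by
  rw [← sub_eq_zero, ← map_sub]
  have hb := hT.abs_apply_le_lintegral (φ - φ')
  have h0 : ∫⁻ x, ‖(φ - φ') x‖ₑ ∂T.variation = 0 := by
    rw [lintegral_eq_zero_iff' (φ - φ').continuous.enorm.measurable.aemeasurable]
    filter_upwards [h] with x hx
    simp [sub_apply, hx]
  rw [h0, ENNReal.toReal_zero] at hb
  exact abs_nonpos_iff.1 hb

end Integrable

/-! ### The extension of a representable current to `L¹(‖T‖)` -/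

section Extend

variable {E : Type*} [NormedAddCommGroup E] [NormedSpace ℝ E] [FiniteDimensional ℝ E]
  [MeasurableSpace E] [BorelSpace E] {Ω : Opens E} {m : ℕ}

/-- The class of a test form in `L¹(‖T‖; ⋀ᵐ E^*)`, a linear map. [cite: Federer1969, 4.1.5] -/
def Current.IsRepresentable.toL1 {T : Current Ω m} (hT : T.IsRepresentable) :
    TestForm Ω m →ₗ[ℝ] (E →₁[T.variation] Covector E m) where
  toFun φ := (hT.integrable_testForm φ).toL1 ⇑φ
  map_add' _ _ := rfl
  map_smul' _ _ := rfl

/-- Unfolding `toL1`. [folklore] -/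
theorem Current.IsRepresentable.toL1_apply {T : Current Ω m} (hT : T.IsRepresentable)
    (φ : TestForm Ω m) : hT.toL1 φ = (hT.integrable_testForm φ).toL1 ⇑φ := rfl

/-- `toL1 φ = φ` a.e. [folklore] -/
theorem Current.IsRepresentable.coeFn_toL1 {T : Current Ω m} (hT : T.IsRepresentable)
    (φ : TestForm Ω m) : ⇑(hT.toL1 φ) =ᵐ[T.variation] ⇑φ :=
  Integrable.coeFn_toL1 (hT.integrable_testForm φ)

/-- `‖toL1 φ‖ = ∫ ‖φ‖ d‖T‖`. [folklore] -/
theorem Current.IsRepresentable.norm_toL1 {T : Current Ω m} (hT : T.IsRepresentable)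
    (φ : TestForm Ω m) : ‖hT.toL1 φ‖ = (∫⁻ x, ‖φ x‖ₑ ∂T.variation).toReal :=
  Integrable.norm_toL1_eq_lintegral_enorm _ (hT.integrable_testForm φ)

/-- **`|T(φ)| ≤ ‖φ‖_{L¹(‖T‖)}`.** [cite: Federer1969, 4.1.5] -/
theorem Current.IsRepresentable.abs_apply_le_norm_toL1 {T : Current Ω m} (hT : T.IsRepresentable)
    (φ : TestForm Ω m) : |T φ| ≤ ‖hT.toL1 φ‖ := by
  rw [hT.norm_toL1]; exact hT.abs_apply_le_lintegral φ

end Extend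

/-! ### Density of test forms in `L¹(‖T‖)` -/

section Density

variable {E : Type*} [NormedAddCommGroup E] [NormedSpace ℝ E] [FiniteDimensional ℝ E]
  [MeasurableSpace E] [BorelSpace E] {Ω : Opens E} {m : ℕ}

omit [FiniteDimensional ℝ E] in
/-- The tail integrals over the complements of an open exhaustion of `Ω` tend to zero, for a
measure living on `Ω`. [folklore] -/
theorem exists_lintegral_compl_lt {ν : Measure E} (hν : ν (Ω : Set E)ᶜ = 0) {f : E → Covector E m}
    (hf : ∫⁻ x, ‖f x‖ₑ ∂ν ≠ ⊤) {O : ℕ → Set E}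
    (hO : ∀ n, IsOpen (O n)) (hmono : Monotone O) (hU : (⋃ n, O n) = (Ω : Set E)) {ε : ℝ≥0∞}
    (hε : ε ≠ 0) : ∃ n, ∫⁻ x in (O n)ᶜ, ‖f x‖ₑ ∂ν < ε := by
  set ρ : Measure E := ν.withDensity fun x => ‖f x‖ₑ with hρ
  have hρO : ∀ n, ρ (O n)ᶜ = ∫⁻ x in (O n)ᶜ, ‖f x‖ₑ ∂ν := fun n =>
    withDensity_apply _ (hO n).measurableSet.compl
  have hanti : Antitone fun n => (O n)ᶜ := fun i j hij => compl_subset_compl.2 (hmono hij)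
  have hlim : Tendsto (fun n => ρ (O n)ᶜ) atTop (𝓝 (ρ (⋂ n, (O n)ᶜ))) :=
    tendsto_measure_iInter_atTop (fun n => (hO n).measurableSet.compl.nullMeasurableSet) hanti
      ⟨0, by rw [hρO]; exact ne_top_of_le_ne_top hf (setLIntegral_le_lintegral _ _)⟩
  have hzero : ρ (⋂ n, (O n)ᶜ) = 0 := by
    rw [← compl_iUnion, hU, hρ, withDensity_apply _ Ω.isOpen.measurableSet.compl]
    exact setLIntegral_measure_zero _ _ hν
  rw [hzero] at hlim
  obtain ⟨n, hn⟩ := (hlim.eventually (gt_mem_nhds (pos_iff_ne_zero.2 hε))).exists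
  exact ⟨n, by rwa [← hρO]⟩

/-- **Test forms are dense in `L¹(‖T‖)`** for a representable current `T`: every
`‖T‖`-integrable form is approximated in `L¹(‖T‖)` by test forms supported in `Ω` (truncate to an
open set with compact closure in `Ω`, approximate by a continuous compactly supported form —
Mathlib's `Integrable.exists_hasCompactSupport_lintegral_sub_le` for the finite, hence regular,
restricted measure —, cut off inside `Ω` and mollify). [cite: Federer1969, 4.1.5] -/
theorem Current.IsRepresentable.denseRange_toL1 {T : Current Ω m} (hT : T.IsRepresentable) :
    DenseRange hT.toL1 := by
  set ν : Measure E := T.variation with hνdef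
  refine Metric.denseRange_iff.2 fun f ε hε => ?_
  -- Step A: a representative and the tail
  have hfi : Integrable (⇑f) ν := L1.integrable_coeFn f
  set ε₁ : ℝ≥0∞ := ENNReal.ofReal (ε / 4) with hε₁
  have hε₁0 : ε₁ ≠ 0 := by rw [hε₁]; exact (ENNReal.ofReal_pos.2 (by linarith)).ne'
  have hε₁top : ε₁ ≠ ⊤ := ENNReal.ofReal_ne_top
  obtain ⟨O, hO, hmono, hcl, hclΩ, hUnion⟩ := exists_isOpen_exhaustion Ω
  obtain ⟨n, hn⟩ := exists_lintegral_compl_lt (ν := ν) T.variation_compl hfi.2.ne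
    hO hmono hUnion hε₁0
  -- Step B: an open set of finite measure around `closure (O n)` and an `L¹` approximation there
  obtain ⟨U, hU, hCU, hUc, hUΩ, hUfin⟩ := hT.exists_isOpen_superset (hcl n) (hclΩ n)
  haveI : IsFiniteMeasure (ν.restrict U) := isFiniteMeasure_restrict.2 hUfin
  set f₁ : E → Covector E m := (O n).indicator ⇑f with hf₁
  have hf₁i : Integrable f₁ (ν.restrict U) := (hfi.indicator (hO n).measurableSet).restrict
  obtain ⟨g, hgc, hg, hgcont, -⟩ := hf₁i.exists_hasCompactSupport_lintegral_sub_le hε₁0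
  -- Step C: cut `g` off inside `U`
  obtain ⟨χ, V', hV', hCV', hχ1, hχ01⟩ :=
    exists_testFunction_eq_one_nhds (Ω := ⟨U, hU⟩) (hcl n) hCU
  set ψ₀ : E → Covector E m := fun x => χ x • g x with hψ₀
  have hψ₀c : Continuous ψ₀ := χ.continuous.smul hgcont
  have hψ₀cs : HasCompactSupport ψ₀ := χ.hasCompactSupport.smul_right
  have hψ₀U : tsupport ψ₀ ⊆ U := (tsupport_smul_subset_left _ _).trans χ.tsupport_subset
  have hpt : ∀ x, ‖f₁ x - ψ₀ x‖ₑ ≤ ‖f₁ x - g x‖ₑ + ‖f₁ x - g x‖ₑ := by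
    intro x
    have hsplit : f₁ x - ψ₀ x = (f₁ x - g x) + (g x - ψ₀ x) := by abel
    rw [hsplit]
    refine (enorm_add_le _ _).trans (add_le_add le_rfl ?_)
    -- `‖g x - χ x • g x‖ ≤ ‖f₁ x - g x‖`
    rw [← ofReal_norm, ← ofReal_norm]
    apply ENNReal.ofReal_le_ofReal
    by_cases hx : x ∈ O n
    · rw [hψ₀]; dsimp only
      rw [hχ1 x (hCV' (subset_closure hx)), one_smul, sub_self, norm_zero]
      exact norm_nonneg _
    · have hf0 : f₁ x = 0 := indicator_of_notMem hx _
      rw [hψ₀]; dsimp only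
      rw [hf0, zero_sub, norm_neg, show g x - χ x • g x = (1 - χ x) • g x by
        rw [sub_smul, one_smul], norm_smul]
      have h01 := hχ01 x
      rw [Real.norm_of_nonneg (by linarith [h01.2])]
      exact mul_le_of_le_one_left (norm_nonneg _) (by linarith [h01.1])
  have hB : ∫⁻ x, ‖f₁ x - ψ₀ x‖ₑ ∂ν ≤ ε₁ + ε₁ := by
    have hind : (fun x => ‖f₁ x - ψ₀ x‖ₑ) = U.indicator fun x => ‖f₁ x - ψ₀ x‖ₑ := by
      funext x
      by_cases hx : x ∈ U
      · rw [indicator_of_mem hx]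
      · rw [indicator_of_notMem hx]
        have h1 : f₁ x = 0 := indicator_of_notMem (fun h => hx (hCU (subset_closure h))) _
        have h2 : ψ₀ x = 0 := image_eq_zero_of_notMem_tsupport fun h => hx (hψ₀U h)
        rw [h1, h2, sub_zero, enorm_zero]
    rw [hind, lintegral_indicator hU.measurableSet]
    calc ∫⁻ x in U, ‖f₁ x - ψ₀ x‖ₑ ∂ν ≤ ∫⁻ x in U, ‖f₁ x - g x‖ₑ + ‖f₁ x - g x‖ₑ ∂ν :=
          lintegral_mono fun x => hpt x
      _ = ∫⁻ x in U, ‖f₁ x - g x‖ₑ ∂ν + ∫⁻ x in U, ‖f₁ x - g x‖ₑ ∂ν :=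
          lintegral_add_right' _ (hf₁i.1.sub hgcont.aestronglyMeasurable).enorm
      _ ≤ ε₁ + ε₁ := add_le_add hg hg
  -- Step D: mollify inside `U`
  set ε' : ℝ := (ε / 4) / ((ν U).toReal + 1) with hε'
  have hε'pos : 0 < ε' := div_pos (by linarith) (by positivity)
  obtain ⟨ψ, hψ, hψcs, hψU, hψa⟩ :=
    exists_contDiff_approx_tsupport_subset hψ₀c hψ₀cs hU hψ₀U hε'pos
  set Ψ : TestForm Ω m := ⟨ψ, hψ, hψcs, hψU.trans (subset_closure.trans hUΩ)⟩ with hΨ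
  have hD : ∫⁻ x, ‖ψ₀ x - ψ x‖ₑ ∂ν ≤ ε₁ := by
    have hind : (fun x => ‖ψ₀ x - ψ x‖ₑ) ≤ U.indicator fun _ => ENNReal.ofReal ε' := by
      intro x
      show ‖ψ₀ x - ψ x‖ₑ ≤ U.indicator (fun _ => ENNReal.ofReal ε') x
      by_cases hx : x ∈ U
      · rw [indicator_of_mem hx, ← ofReal_norm, norm_sub_rev]
        exact ENNReal.ofReal_le_ofReal (hψa x)
      · rw [indicator_of_notMem hx]
        have h1 : ψ₀ x = 0 := image_eq_zero_of_notMem_tsupport fun h => hx (hψ₀U h)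
        have h2 : ψ x = 0 := image_eq_zero_of_notMem_tsupport fun h => hx (hψU h)
        rw [h1, h2, sub_zero, enorm_zero]
    calc ∫⁻ x, ‖ψ₀ x - ψ x‖ₑ ∂ν ≤ ∫⁻ x, U.indicator (fun _ => ENNReal.ofReal ε') x ∂ν :=
          lintegral_mono hind
      _ = ENNReal.ofReal ε' * ν U := by
          rw [lintegral_indicator hU.measurableSet, setLIntegral_const]
      _ = ENNReal.ofReal (ε' * (ν U).toReal) := by
          rw [ENNReal.ofReal_mul hε'pos.le, ENNReal.ofReal_toReal hUfin]
      _ ≤ ε₁ := by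
          rw [hε₁]
          apply ENNReal.ofReal_le_ofReal
          rw [hε', div_mul_eq_mul_div, div_le_iff₀ (by positivity)]
          nlinarith [ENNReal.toReal_nonneg (a := ν U)]
  -- Step E: assemble
  have hA : ∫⁻ x, ‖f x - f₁ x‖ₑ ∂ν < ε₁ := by
    have : (fun x => ‖f x - f₁ x‖ₑ) = (O n)ᶜ.indicator fun x => ‖f x‖ₑ := by
      funext x
      by_cases hx : x ∈ O n
      · rw [indicator_of_notMem (show x ∉ (O n)ᶜ from fun h => h hx), hf₁, indicator_of_mem hx,
          sub_self, enorm_zero]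
      · rw [indicator_of_mem hx, hf₁, indicator_of_notMem hx, sub_zero]
    rwa [this, lintegral_indicator (hO n).measurableSet.compl]
  have htot : ∫⁻ x, ‖f x - ψ x‖ₑ ∂ν < ENNReal.ofReal ε := by
    have hpt' : ∀ x, ‖f x - ψ x‖ₑ ≤ ‖f x - f₁ x‖ₑ + ‖f₁ x - ψ₀ x‖ₑ + ‖ψ₀ x - ψ x‖ₑ := by
      intro x
      have : f x - ψ x = (f x - f₁ x) + (f₁ x - ψ₀ x) + (ψ₀ x - ψ x) := by abel
      rw [this]
      exact (enorm_add_le _ _).trans (add_le_add (enorm_add_le _ _) le_rfl)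
    have hm1 : AEMeasurable (fun x => ‖f x - f₁ x‖ₑ) ν :=
      (hfi.1.sub (hfi.1.indicator (hO n).measurableSet)).enorm
    have hm2 : AEMeasurable (fun x => ‖f₁ x - ψ₀ x‖ₑ) ν :=
      ((hfi.1.indicator (hO n).measurableSet).sub hψ₀c.aestronglyMeasurable).enorm
    calc ∫⁻ x, ‖f x - ψ x‖ₑ ∂ν
        ≤ ∫⁻ x, ‖f x - f₁ x‖ₑ + ‖f₁ x - ψ₀ x‖ₑ + ‖ψ₀ x - ψ x‖ₑ ∂ν := lintegral_mono hpt'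
      _ = ∫⁻ x, ‖f x - f₁ x‖ₑ ∂ν + ∫⁻ x, ‖f₁ x - ψ₀ x‖ₑ ∂ν + ∫⁻ x, ‖ψ₀ x - ψ x‖ₑ ∂ν := by
          rw [lintegral_add_left' (f := fun x => ‖f x - f₁ x‖ₑ + ‖f₁ x - ψ₀ x‖ₑ) (hm1.add hm2),
            lintegral_add_left' hm1]
      _ < ε₁ + (ε₁ + ε₁) + ε₁ := by
          have hfinB : ∫⁻ x, ‖f₁ x - ψ₀ x‖ₑ ∂ν ≠ ⊤ :=
            ne_top_of_le_ne_top (ENNReal.add_ne_top.2 ⟨hε₁top, hε₁top⟩) hB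
          refine ENNReal.add_lt_add_of_lt_of_le (ne_top_of_le_ne_top hε₁top hD) ?_ hD
          exact ENNReal.add_lt_add_of_lt_of_le hfinB hA hB
      _ = ENNReal.ofReal ε := by
          have h4 : ENNReal.ofReal (ε / 4) + (ENNReal.ofReal (ε / 4) + ENNReal.ofReal (ε / 4)) +
              ENNReal.ofReal (ε / 4) = ENNReal.ofReal (ε / 4 + (ε / 4 + ε / 4) + ε / 4) := by
            rw [ENNReal.ofReal_add (by positivity) (by positivity),
              ENNReal.ofReal_add (by positivity) (by positivity),
              ENNReal.ofReal_add (by positivity) (by positivity)]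
          rw [hε₁, h4]
          congr 1; ring
  refine ⟨Ψ, ?_⟩
  rw [dist_eq_norm, Lp.norm_def, eLpNorm_one_eq_lintegral_enorm]
  have hae : (fun x => ‖(f - hT.toL1 Ψ) x‖ₑ) =ᵐ[ν] fun x => ‖f x - ψ x‖ₑ := by
    filter_upwards [Lp.coeFn_sub f (hT.toL1 Ψ), hT.coeFn_toL1 Ψ] with x hx hx'
    rw [hx, Pi.sub_apply, hx']
    rfl
  rw [lintegral_congr_ae hae]
  exact ENNReal.toReal_lt_of_lt_ofReal htot

end Density

/-! ### The extension `T̄ : L¹(‖T‖) → ℝ` -/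

section Extension

variable {E : Type*} [NormedAddCommGroup E] [NormedSpace ℝ E] [FiniteDimensional ℝ E]
  [MeasurableSpace E] [BorelSpace E] {Ω : Opens E} {m : ℕ}

/-- **The extension of a representable current to `L¹(‖T‖)`** [Federer1969, 4.1.5: "we extend
… to a `‖T‖` measurable … linear" functional; there realised as `T(φ) = ∫ ⟨φ, T⃗⟩ d‖T‖`]: the
unique continuous linear functional `T̄` on `L¹(‖T‖; ⋀ᵐ E^*)` with `T̄ [φ] = T(φ)` for test forms
(Mathlib's `LinearMap.extendOfNorm` along the dense map `toL1`, bound `|T φ| ≤ ‖[φ]‖₁`).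
[cite: Federer1969, 4.1.5] -/
def Current.IsRepresentable.extend {T : Current Ω m} (hT : T.IsRepresentable) :
    (E →₁[T.variation] Covector E m) →L[ℝ] ℝ :=
  (T : TestForm Ω m →ₗ[ℝ] ℝ).extendOfNorm hT.toL1

/-- The norm bound feeding `extendOfNorm`. [folklore] -/
theorem Current.IsRepresentable.norm_apply_le_one_mul {T : Current Ω m} (hT : T.IsRepresentable)
    (φ : TestForm Ω m) : ‖(T : TestForm Ω m →ₗ[ℝ] ℝ) φ‖ ≤ 1 * ‖hT.toL1 φ‖ := by
  rw [one_mul, Real.norm_eq_abs]; exact hT.abs_apply_le_norm_toL1 φ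

/-- **`T̄ [φ] = T(φ)`** for test forms. [cite: Federer1969, 4.1.5] -/
@[simp] theorem Current.IsRepresentable.extend_toL1 {T : Current Ω m} (hT : T.IsRepresentable)
    (φ : TestForm Ω m) : hT.extend (hT.toL1 φ) = T φ :=
  LinearMap.extendOfNorm_eq hT.denseRange_toL1 ⟨1, hT.norm_apply_le_one_mul⟩ φ

/-- **`|T̄ f| ≤ ‖f‖₁ = ∫ ‖f‖ d‖T‖`.** [cite: Federer1969, 4.1.5] -/
theorem Current.IsRepresentable.abs_extend_le {T : Current Ω m} (hT : T.IsRepresentable)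
    (f : E →₁[T.variation] Covector E m) : |hT.extend f| ≤ ‖f‖ := by
  have h := LinearMap.norm_extendOfNorm_apply_le hT.denseRange_toL1 1 hT.norm_apply_le_one_mul f
  rwa [one_mul, Real.norm_eq_abs] at h

/-- `|T̄ f| ≤ ∫ ‖f‖ d‖T‖`. [cite: Federer1969, 4.1.5] -/
theorem Current.IsRepresentable.abs_extend_le_lintegral {T : Current Ω m} (hT : T.IsRepresentable)
    (f : E →₁[T.variation] Covector E m) :
    |hT.extend f| ≤ (∫⁻ x, ‖f x‖ₑ ∂T.variation).toReal := by
  have h := hT.abs_extend_le f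
  rwa [Lp.norm_def, eLpNorm_one_eq_lintegral_enorm] at h

/-- **Uniqueness of the extension**: a continuous linear functional on `L¹(‖T‖)` agreeing with `T`
on test forms is `T̄`. [cite: Federer1969, 4.1.5] -/
theorem Current.IsRepresentable.eq_extend {T : Current Ω m} (hT : T.IsRepresentable)
    (L : (E →₁[T.variation] Covector E m) →L[ℝ] ℝ) (h : ∀ φ, L (hT.toL1 φ) = T φ) :
    L = hT.extend :=
  (LinearMap.extendOfNorm_unique hT.denseRange_toL1 1 hT.norm_apply_le_one_mul L
    (LinearMap.ext fun φ => h φ)).symm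

/-- `T̄` applied to an integrable form: `T̄ [f]`. [cite: Federer1969, 4.1.5] -/
theorem Current.IsRepresentable.abs_extend_toL1_le {T : Current Ω m} (hT : T.IsRepresentable)
    {f : E → Covector E m} (hf : Integrable f T.variation) :
    |hT.extend (hf.toL1 f)| ≤ (∫⁻ x, ‖f x‖ₑ ∂T.variation).toReal := by
  have h := hT.abs_extend_le (hf.toL1 f)
  rwa [Integrable.norm_toL1_eq_lintegral_enorm] at h

end Extension

/-! ### Restriction of a representable current to a Borel set: `T ⌞ A` -/

section RestrictSet

variable {E : Type*} [NormedAddCommGroup E] [NormedSpace ℝ E] [FiniteDimensional ℝ E]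
  [MeasurableSpace E] [BorelSpace E] {Ω : Opens E} {m : ℕ}

/-- `toL1` only depends on the function. [folklore] -/
theorem Integrable.toL1_congr_eq {α F : Type*} [MeasurableSpace α] {μ : Measure α}
    [NormedAddCommGroup F] {f g : α → F} (hf : Integrable f μ) (hg : Integrable g μ) (h : f = g) :
    hf.toL1 f = hg.toL1 g := by
  subst h; rfl

/-- The value of `T ⌞ A` on a test form: `T̄ [1_A φ]`. [cite: Federer1969, 4.1.7] -/
def Current.IsRepresentable.restrictFun {T : Current Ω m} (hT : T.IsRepresentable) (A : Set E)
    (hA : MeasurableSet A) (φ : TestForm Ω m) : ℝ :=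
  hT.extend (((hT.integrable_testForm φ).indicator hA).toL1 (A.indicator ⇑φ))

/-- `restrictFun` is additive. [folklore] -/
theorem Current.IsRepresentable.restrictFun_add {T : Current Ω m} (hT : T.IsRepresentable)
    (A : Set E) (hA : MeasurableSet A) (φ ψ : TestForm Ω m) :
    hT.restrictFun A hA (φ + ψ) = hT.restrictFun A hA φ + hT.restrictFun A hA ψ := by
  unfold Current.IsRepresentable.restrictFun
  rw [← map_add, ← Integrable.toL1_add]
  congr 1
  exact Integrable.toL1_congr_eq _ _ (by rw [FunLike.coe_add, indicator_add'])

/-- `restrictFun` is homogeneous. [folklore] -/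
theorem Current.IsRepresentable.restrictFun_smul {T : Current Ω m} (hT : T.IsRepresentable)
    (A : Set E) (hA : MeasurableSet A) (c : ℝ) (φ : TestForm Ω m) :
    hT.restrictFun A hA (c • φ) = c • hT.restrictFun A hA φ := by
  unfold Current.IsRepresentable.restrictFun
  rw [← map_smul, ← Integrable.toL1_smul']
  congr 1
  refine Integrable.toL1_congr_eq _ _ ?_
  show A.indicator (fun x => c • φ x) = fun x => c • A.indicator ⇑φ x
  exact indicator_const_smul A c ⇑φ

/-- **`|(T ⌞ A)(φ)| ≤ ∫_A ‖φ‖ d‖T‖`.** [cite: Federer1969, 4.1.7] -/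
theorem Current.IsRepresentable.abs_restrictFun_le {T : Current Ω m} (hT : T.IsRepresentable)
    (A : Set E) (hA : MeasurableSet A) (φ : TestForm Ω m) :
    |hT.restrictFun A hA φ| ≤ (∫⁻ x in A, ‖φ x‖ₑ ∂T.variation).toReal := by
  have h := hT.abs_extend_toL1_le ((hT.integrable_testForm φ).indicator hA)
  have h' : ∫⁻ x, ‖A.indicator (⇑φ) x‖ₑ ∂T.variation = ∫⁻ x in A, ‖φ x‖ₑ ∂T.variation := by
    rw [← lintegral_indicator hA]
    exact lintegral_congr fun x => by rw [enorm_indicator_eq_indicator_enorm]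
  rwa [h'] at h

/-- `|(T ⌞ A)(φ)| ≤ sup ‖φ‖ · ‖T‖(A ∩ spt φ)`-type bound: `≤ c · ‖T‖(K)` for `φ` supported in `K`
with `‖φ‖ ≤ c`. [cite: Federer1969, 4.1.7] -/
theorem Current.IsRepresentable.abs_restrictFun_le_mul {T : Current Ω m} (hT : T.IsRepresentable)
    (A : Set E) (hA : MeasurableSet A) {φ : TestForm Ω m} {c : ℝ} (hc : 0 ≤ c)
    (hφ : ∀ x, ‖φ x‖ ≤ c) {K : Set E} (hK : MeasurableSet K) (hφK : tsupport ⇑φ ⊆ K)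
    (hfin : T.variation K ≠ ⊤) : |hT.restrictFun A hA φ| ≤ c * (T.variation (A ∩ K)).toReal := by
  refine (hT.abs_restrictFun_le A hA φ).trans ?_
  have h1 : ∫⁻ x in A, ‖φ x‖ₑ ∂T.variation ≤ ENNReal.ofReal c * T.variation (A ∩ K) := by
    have hle : (fun x => ‖φ x‖ₑ) ≤ K.indicator fun _ => ENNReal.ofReal c := by
      intro x
      show ‖φ x‖ₑ ≤ K.indicator (fun _ => ENNReal.ofReal c) x
      by_cases hx : x ∈ K
      · rw [indicator_of_mem hx, ← ofReal_norm]; exact ENNReal.ofReal_le_ofReal (hφ x)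
      · rw [indicator_of_notMem hx, image_eq_zero_of_notMem_tsupport fun h => hx (hφK h),
          enorm_zero]
    calc ∫⁻ x in A, ‖φ x‖ₑ ∂T.variation ≤ ∫⁻ x in A, K.indicator (fun _ => ENNReal.ofReal c) x
        ∂T.variation := lintegral_mono hle
      _ = ENNReal.ofReal c * T.variation (A ∩ K) := by
          rw [lintegral_indicator hK, setLIntegral_const, Measure.restrict_apply hK, inter_comm,
            mul_comm]
  have hfin' : T.variation (A ∩ K) ≠ ⊤ := ne_top_of_le_ne_top hfin (measure_mono inter_subset_right)
  have := ENNReal.toReal_mono (ENNReal.mul_ne_top ENNReal.ofReal_ne_top hfin') h1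
  rwa [ENNReal.toReal_mul, ENNReal.toReal_ofReal hc] at this

/-- `T ⌞ A` on the step `𝓓_K` of the inductive limit, as a linear functional. [folklore] -/
def Current.IsRepresentable.restrictFunLM {T : Current Ω m} (hT : T.IsRepresentable) (A : Set E)
    (hA : MeasurableSet A) {K : Compacts E} (hK : (K : Set E) ⊆ Ω) :
    𝓓_{K}(E, Covector E m) →ₗ[ℝ] ℝ where
  toFun φ := hT.restrictFun A hA (TestFunction.ofSupportedInCLM ℝ hK φ)
  map_add' φ ψ := by rw [map_add]; exact hT.restrictFun_add A hA _ _
  map_smul' c φ := by rw [map_smul]; exact hT.restrictFun_smul A hA c _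

/-- The bound `|(T ⌞ A)(φ)| ≤ ‖T‖(K) · sup ‖φ‖` on `𝓓_K`, `K ⊆ Ω` compact. [cite: Federer1969, 4.1.7] -/
theorem Current.IsRepresentable.norm_restrictFunLM_le {T : Current Ω m} (hT : T.IsRepresentable)
    (A : Set E) (hA : MeasurableSet A) {K : Compacts E} (hK : (K : Set E) ⊆ Ω)
    (φ : 𝓓_{K}(E, Covector E m)) :
    ‖hT.restrictFunLM A hA hK φ‖ ≤ (T.variation (K : Set E)).toReal *
      ContDiffMapSupportedIn.seminorm ℝ E (Covector E m) ⊤ K 0 φ := by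
  have hKfin : T.variation (K : Set E) ≠ ⊤ := hT K K.isCompact hK
  rw [Real.norm_eq_abs, mul_comm]
  refine (hT.abs_restrictFun_le_mul A hA
    (apply_nonneg (ContDiffMapSupportedIn.seminorm ℝ E (Covector E m) ⊤ K 0) φ) (fun x => ?_)
    K.isCompact.isClosed.measurableSet φ.tsupport_subset hKfin).trans ?_
  · exact ContDiffMapSupportedIn.norm_apply_le_seminorm ℝ
  · exact mul_le_mul_of_nonneg_left (ENNReal.toReal_mono hKfin (measure_mono
      inter_subset_right))
      (apply_nonneg (ContDiffMapSupportedIn.seminorm ℝ E (Covector E m) ⊤ K 0) φ)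

/-- Continuity of `T ⌞ A` on `𝓓_K`. [folklore] -/
theorem Current.IsRepresentable.continuous_restrictFunLM {T : Current Ω m}
    (hT : T.IsRepresentable) (A : Set E) (hA : MeasurableSet A) {K : Compacts E}
    (hK : (K : Set E) ⊆ Ω) : Continuous (hT.restrictFunLM A hA hK) :=
  WithSeminorms.continuous_of_isBounded
    (ContDiffMapSupportedIn.withSeminorms ℝ E (Covector E m) ⊤ K) (norm_withSeminorms ℝ ℝ)
    (hT.restrictFunLM A hA hK) (.of_real fun _ => ⟨{0}, (T.variation (K : Set E)).toReal,
      fun φ => by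
        rw [Finset.sup_singleton]; exact hT.norm_restrictFunLM_le A hA hK φ⟩)

/-- **The restriction `T ⌞ A` of a representable current to a Borel set `A`** [Federer1969,
4.1.7: "`(T ⌞ A)(φ) = ∫_A ⟨φ, T⃗⟩ d‖T‖`", defined there for all `‖T‖` measurable `A` when `T` is
representable by integration]: the current `φ ↦ T̄ [1_A φ]`. Continuity on each `𝒟_K`: the value
is bounded by `sup ‖φ‖ · ‖T‖(K)`. [cite: Federer1969, 4.1.7] -/
def Current.IsRepresentable.restrictSet {T : Current Ω m} (hT : T.IsRepresentable) (A : Set E)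
    (hA : MeasurableSet A) : Current Ω m :=
  TestFunction.mkCLM ℝ (hT.restrictFun A hA) (hT.restrictFun_add A hA) (hT.restrictFun_smul A hA)
    fun _ hK => hT.continuous_restrictFunLM A hA hK

/-- Unfolding: `(T ⌞ A)(φ) = T̄ [1_A φ]`. [cite: Federer1969, 4.1.7] -/
theorem Current.IsRepresentable.restrictSet_apply {T : Current Ω m} (hT : T.IsRepresentable)
    (A : Set E) (hA : MeasurableSet A) (φ : TestForm Ω m) :
    hT.restrictSet A hA φ = hT.extend (((hT.integrable_testForm φ).indicator hA).toL1
      (A.indicator ⇑φ)) := rfl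

/-- **`|(T ⌞ A)(φ)| ≤ ∫_A ‖φ‖ d‖T‖`.** [cite: Federer1969, 4.1.7] -/
theorem Current.IsRepresentable.abs_restrictSet_apply_le {T : Current Ω m}
    (hT : T.IsRepresentable) (A : Set E) (hA : MeasurableSet A) (φ : TestForm Ω m) :
    |hT.restrictSet A hA φ| ≤ (∫⁻ x in A, ‖φ x‖ₑ ∂T.variation).toReal :=
  hT.abs_restrictFun_le A hA φ

/-- `T ⌞ A` depends only on the `‖T‖`-a.e. class of `A`… in particular on `A` through `1_A φ`:
two sets on which every test form has the same indicator a.e. give the same restriction.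
Here: `A = B` a.e. [cite: Federer1969, 4.1.7] -/
theorem Current.IsRepresentable.restrictSet_congr_ae {T : Current Ω m} (hT : T.IsRepresentable)
    {A B : Set E} (hA : MeasurableSet A) (hB : MeasurableSet B)
    (h : (A : Set E) =ᵐ[T.variation] B) : hT.restrictSet A hA = hT.restrictSet B hB := by
  ext φ
  rw [hT.restrictSet_apply, hT.restrictSet_apply]
  congr 1
  exact (Integrable.toL1_eq_toL1_iff _ _ _ _).2
    (h.mono fun x hx => by
      by_cases hxA : x ∈ A
      · have hxB : x ∈ B := Eq.mp hx hxA
        rw [indicator_of_mem hxA, indicator_of_mem hxB]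
      · have hxB : x ∉ B := fun hb => hxA (Eq.mpr hx hb)
        rw [indicator_of_notMem hxA, indicator_of_notMem hxB])

/-- **`T ⌞ E = T`** (and `T ⌞ Ω = T`). [cite: Federer1969, 4.1.7] -/
theorem Current.IsRepresentable.restrictSet_univ {T : Current Ω m} (hT : T.IsRepresentable) :
    hT.restrictSet univ MeasurableSet.univ = T := by
  ext φ
  rw [hT.restrictSet_apply]
  have : ((hT.integrable_testForm φ).indicator MeasurableSet.univ).toL1 (univ.indicator ⇑φ) =
      hT.toL1 φ := Integrable.toL1_congr_eq _ (hT.integrable_testForm φ) (indicator_univ _)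
  rw [this, hT.extend_toL1]

/-- `T ⌞ ∅ = 0`. [folklore] -/
theorem Current.IsRepresentable.restrictSet_empty {T : Current Ω m} (hT : T.IsRepresentable) :
    hT.restrictSet ∅ MeasurableSet.empty = 0 := by
  ext φ
  rw [hT.restrictSet_apply]
  have : ((hT.integrable_testForm φ).indicator MeasurableSet.empty).toL1 ((∅ : Set E).indicator ⇑φ)
      = 0 := by
    rw [← Integrable.toL1_zero (integrable_zero E (Covector E m) T.variation)]
    exact Integrable.toL1_congr_eq _ _ (indicator_empty _)
  rw [this, map_zero]
  rfl

/-- **Additivity on disjoint sets**: `T ⌞ (A ∪ B) = T ⌞ A + T ⌞ B`. [cite: Federer1969, 4.1.7] -/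
theorem Current.IsRepresentable.restrictSet_union {T : Current Ω m} (hT : T.IsRepresentable)
    {A B : Set E} (hA : MeasurableSet A) (hB : MeasurableSet B) (h : Disjoint A B) :
    hT.restrictSet (A ∪ B) (hA.union hB) = hT.restrictSet A hA + hT.restrictSet B hB := by
  ext φ
  rw [show (hT.restrictSet A hA + hT.restrictSet B hB) φ =
      hT.restrictSet A hA φ + hT.restrictSet B hB φ from rfl, hT.restrictSet_apply,
    hT.restrictSet_apply, hT.restrictSet_apply, ← map_add, ← Integrable.toL1_add]
  congr 1
  exact Integrable.toL1_congr_eq _ _ (indicator_union_of_disjoint h _)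

/-- **`T ⌞ A + T ⌞ (E ∖ A) = T`.** [cite: Federer1969, 4.1.7] -/
theorem Current.IsRepresentable.restrictSet_add_compl {T : Current Ω m} (hT : T.IsRepresentable)
    {A : Set E} (hA : MeasurableSet A) :
    hT.restrictSet A hA + hT.restrictSet Aᶜ hA.compl = T := by
  rw [← hT.restrictSet_union hA hA.compl disjoint_compl_right]
  conv_rhs => rw [← hT.restrictSet_univ]
  congr 1
  exact union_compl_self A

/-- If `spt φ ⊆ A` then `(T ⌞ A)(φ) = T(φ)`. [cite: Federer1969, 4.1.7] -/
theorem Current.IsRepresentable.restrictSet_apply_of_support_subset {T : Current Ω m}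
    (hT : T.IsRepresentable) {A : Set E} (hA : MeasurableSet A) {φ : TestForm Ω m}
    (h : Function.support ⇑φ ⊆ A) : hT.restrictSet A hA φ = T φ := by
  rw [hT.restrictSet_apply]
  have : ((hT.integrable_testForm φ).indicator hA).toL1 (A.indicator ⇑φ) = hT.toL1 φ :=
    Integrable.toL1_congr_eq _ (hT.integrable_testForm φ) (indicator_eq_self.2 h)
  rw [this, hT.extend_toL1]

/-- If `spt φ ∩ A = ∅` then `(T ⌞ A)(φ) = 0`. [cite: Federer1969, 4.1.7] -/
theorem Current.IsRepresentable.restrictSet_apply_of_disjoint {T : Current Ω m}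
    (hT : T.IsRepresentable) {A : Set E} (hA : MeasurableSet A) {φ : TestForm Ω m}
    (h : Disjoint (Function.support ⇑φ) A) : hT.restrictSet A hA φ = 0 := by
  rw [hT.restrictSet_apply]
  have : ((hT.integrable_testForm φ).indicator hA).toL1 (A.indicator ⇑φ) = 0 := by
    rw [← Integrable.toL1_zero (integrable_zero E (Covector E m) T.variation)]
    refine Integrable.toL1_congr_eq _ _ (funext fun x => ?_)
    by_cases hx : x ∈ A
    · rw [indicator_of_mem hx, Pi.zero_apply]; exact notMem_support.1 (h.notMem_of_mem_right hx)
    · rw [indicator_of_notMem hx, Pi.zero_apply]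
  rw [this, map_zero]

/-- **`‖T ⌞ A‖(U) ≤ ‖T‖(A ∩ U)`** on every set `U`. [cite: Federer1969, 4.1.7] -/
theorem Current.IsRepresentable.variationOn_restrictSet_le {T : Current Ω m}
    (hT : T.IsRepresentable) {A : Set E} (hA : MeasurableSet A) (U : Set E) :
    (hT.restrictSet A hA).variationOn U ≤ T.variation (A ∩ U) := by
  refine iSup_le fun φ => iSup_le fun hφ => iSup_le fun hU => ?_
  have hX : ∫⁻ x in A, ‖φ x‖ₑ ∂T.variation ≤ T.variation (A ∩ U) := by
    have hle : (fun x => ‖φ x‖ₑ) ≤ (tsupport ⇑φ).indicator 1 := by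
      intro x
      show ‖φ x‖ₑ ≤ (tsupport ⇑φ).indicator 1 x
      by_cases hx : x ∈ tsupport ⇑φ
      · rw [indicator_of_mem hx, Pi.one_apply, ← ofReal_norm]
        exact ENNReal.ofReal_le_one.2 (hφ x)
      · rw [indicator_of_notMem hx, image_eq_zero_of_notMem_tsupport hx, enorm_zero]
    calc ∫⁻ x in A, ‖φ x‖ₑ ∂T.variation ≤ ∫⁻ x in A, (tsupport ⇑φ).indicator 1 x ∂T.variation :=
          lintegral_mono hle
      _ = T.variation (tsupport ⇑φ ∩ A) := by
          rw [lintegral_indicator_one (isClosed_tsupport _).measurableSet,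
            Measure.restrict_apply (isClosed_tsupport _).measurableSet]
      _ ≤ T.variation (A ∩ U) := measure_mono fun x hx => ⟨hx.2, hU hx.1⟩
  calc ENNReal.ofReal (hT.restrictSet A hA φ) ≤ ENNReal.ofReal |hT.restrictSet A hA φ| :=
        ENNReal.ofReal_le_ofReal (le_abs_self _)
    _ ≤ ENNReal.ofReal (∫⁻ x in A, ‖φ x‖ₑ ∂T.variation).toReal :=
        ENNReal.ofReal_le_ofReal (hT.abs_restrictSet_apply_le A hA φ)
    _ ≤ ∫⁻ x in A, ‖φ x‖ₑ ∂T.variation := ENNReal.ofReal_toReal_le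
    _ ≤ T.variation (A ∩ U) := hX

/-- **`𝐌(T ⌞ A) ≤ ‖T‖(A)`.** [cite: Federer1969, 4.1.7] -/
theorem Current.IsRepresentable.mass_restrictSet_le {T : Current Ω m} (hT : T.IsRepresentable)
    {A : Set E} (hA : MeasurableSet A) : (hT.restrictSet A hA).mass ≤ T.variation A := by
  rw [← Current.variationOn_univ]
  simpa using hT.variationOn_restrictSet_le hA univ

/-- **`‖T ⌞ A‖ ≤ ‖T‖`** as measures. [cite: Federer1969, 4.1.7] -/
theorem Current.IsRepresentable.variation_restrictSet_le {T : Current Ω m}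
    (hT : T.IsRepresentable) {A : Set E} (hA : MeasurableSet A) :
    (hT.restrictSet A hA).variation ≤ T.variation := by
  refine Measure.le_intro fun B hB _ => ?_
  rw [(hT.restrictSet A hA).variation_eq_iInf_isOpen hB, T.variation_eq_iInf_isOpen hB]
  refine iInf_mono fun U => iInf_mono' fun hU => ⟨hU, iInf_mono fun _ => ?_⟩
  rw [← T.variation_apply_of_isOpen hU]
  exact (hT.variationOn_restrictSet_le hA U).trans (measure_mono inter_subset_right)

/-- `T ⌞ A` is again representable. [cite: Federer1969, 4.1.7] -/
theorem Current.IsRepresentable.restrictSet_isRepresentable {T : Current Ω m}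
    (hT : T.IsRepresentable) {A : Set E} (hA : MeasurableSet A) :
    (hT.restrictSet A hA).IsRepresentable := fun K hK hKΩ =>
  ne_top_of_le_ne_top (hT K hK hKΩ) (hT.variation_restrictSet_le hA K)

end RestrictSet

/-! ### `(μ ∧ F) ⌞ A = (μ ⌞ A) ∧ F` and `[W, θ, ξ] ⌞ A = [W ∩ A, θ, ξ]` -/

section RestrictIntegration

variable {V : Type*} [NormedAddCommGroup V] [InnerProductSpace ℝ V] [FiniteDimensional ℝ V]
  [MeasurableSpace V] [BorelSpace V] {Ω : Opens V} {m : ℕ}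

omit [FiniteDimensional ℝ V] [BorelSpace V] in
/-- Local integrability passes to restricted measures. [folklore] -/
theorem locallyIntegrableOn_restrict_measure {μ : Measure V} {F : V → Multivector V m}
    (hF : LocallyIntegrableOn F (Ω : Set V) μ) (A : Set V) :
    LocallyIntegrableOn F (Ω : Set V) (μ.restrict A) := fun x hx =>
  let ⟨U, hU, hi⟩ := hF x hx
  ⟨U, hU, hi.mono_measure Measure.restrict_le_self⟩

/-- **`∫ ‖h‖ d‖μ ∧ F‖ = ∫_Ω ‖F‖ ‖h‖ dμ`.** [cite: Federer1969, 4.1.5] -/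
theorem lintegral_enorm_variation_vectorCurrent {μ : Measure V} {F : V → Multivector V m}
    (hF : LocallyIntegrableOn F (Ω : Set V) μ) (h : V → Covector V m) :
    ∫⁻ x, ‖h x‖ₑ ∂(vectorCurrent μ F : Current Ω m).variation =
      ∫⁻ x in (Ω : Set V), ‖F x‖ₑ * ‖h x‖ₑ ∂μ := by
  rw [variation_vectorCurrent_eq hF, restrict_withDensity Ω.isOpen.measurableSet,
    lintegral_withDensity_eq_lintegral_mul_non_measurable₀ _ hF.aestronglyMeasurable.enorm
      (Eventually.of_forall fun x => enorm_lt_top)]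
  rfl

omit [FiniteDimensional ℝ V] in
/-- The pairing `x ↦ F x (1_A φ x)` is `μ`-integrable. [folklore] -/
theorem integrable_apply_indicator {μ : Measure V} {F : V → Multivector V m}
    (hF : LocallyIntegrableOn F (Ω : Set V) μ) {A : Set V} (hA : MeasurableSet A)
    (φ : TestForm Ω m) : Integrable (fun x => F x (A.indicator ⇑φ x)) μ := by
  have h := (TestFunction.integrable_bilin (covectorPairing V m) hF φ).indicator hA
  refine h.congr (Eventually.of_forall fun x => ?_)
  by_cases hx : x ∈ A
  · simp [indicator_of_mem hx, covectorPairing]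
  · simp [indicator_of_notMem hx]

/-- **`|∫ F(h₁) dμ − ∫ F(h₂) dμ| ≤ ‖[h₁] − [h₂]‖_{L¹(‖μ∧F‖)}`**: the pairing against `F` is
`1`-Lipschitz for the `L¹(‖μ ∧ F‖)`-distance, for forms vanishing off `Ω`. [cite: Federer1969, 4.1.5] -/
theorem norm_integral_apply_sub_le {μ : Measure V} {F : V → Multivector V m}
    (hF : LocallyIntegrableOn F (Ω : Set V) μ) {h₁ h₂ : V → Covector V m}
    (hi₁ : Integrable (fun x => F x (h₁ x)) μ) (hi₂ : Integrable (fun x => F x (h₂ x)) μ)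
    (hz : ∀ x ∉ (Ω : Set V), h₁ x - h₂ x = 0)
    (hfin : ∫⁻ x, ‖h₁ x - h₂ x‖ₑ ∂(vectorCurrent μ F : Current Ω m).variation ≠ ⊤) :
    ‖∫ x, F x (h₁ x) ∂μ - ∫ x, F x (h₂ x) ∂μ‖ ≤
      (∫⁻ x, ‖h₁ x - h₂ x‖ₑ ∂(vectorCurrent μ F : Current Ω m).variation).toReal := by
  rw [lintegral_enorm_variation_vectorCurrent hF] at hfin ⊢
  rw [← integral_sub hi₁ hi₂]
  refine (norm_integral_le_lintegral_norm _).trans (ENNReal.toReal_mono hfin ?_)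
  calc ∫⁻ x, ENNReal.ofReal ‖F x (h₁ x) - F x (h₂ x)‖ ∂μ = ∫⁻ x, ‖F x (h₁ x - h₂ x)‖ₑ ∂μ := by
        simp_rw [ofReal_norm, map_sub]
    _ ≤ ∫⁻ x, ‖F x‖ₑ * ‖h₁ x - h₂ x‖ₑ ∂μ := lintegral_mono fun x => by
        rw [← ofReal_norm, ← ofReal_norm, ← ofReal_norm, ← ENNReal.ofReal_mul (norm_nonneg _)]
        exact ENNReal.ofReal_le_ofReal ((F x).le_opNorm _)
    _ = ∫⁻ x in (Ω : Set V), ‖F x‖ₑ * ‖h₁ x - h₂ x‖ₑ ∂μ := by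
        rw [← lintegral_indicator Ω.isOpen.measurableSet]
        refine lintegral_congr fun x => ?_
        by_cases hx : x ∈ (Ω : Set V)
        · rw [indicator_of_mem hx]
        · rw [indicator_of_notMem hx, hz x hx, enorm_zero, mul_zero]

/-- **`(μ ∧ F) ⌞ A = (μ ⌞ A) ∧ F`**: the restriction of a current representable by integration to a
Borel set is integration over that set [Federer1969, 4.1.7: `(T ⌞ A)(φ) = ∫_A ⟨φ, T⃗⟩ d‖T‖`].
Proof: `T̄ [1_A φ]` is the limit of `T(ψₙ) = ∫ F(ψₙ) dμ` along test forms `[ψₙ] → [1_A φ]` in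
`L¹(‖T‖)`, and `∫ F(ψₙ) dμ → ∫_A F(φ) dμ` by the `L¹` bound. [cite: Federer1969, 4.1.7] -/
theorem restrictSet_vectorCurrent {μ : Measure V} {F : V → Multivector V m}
    (hF : LocallyIntegrableOn F (Ω : Set V) μ) {A : Set V} (hA : MeasurableSet A) :
    (isRepresentable_vectorCurrent hF).restrictSet A hA =
      (vectorCurrent (μ.restrict A) F : Current Ω m) := by
  have hT : (vectorCurrent μ F : Current Ω m).IsRepresentable := isRepresentable_vectorCurrent hF
  ext φ
  rw [hT.restrictSet_apply, vectorCurrent_apply (locallyIntegrableOn_restrict_measure hF A) φ,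
    ← integral_indicator hA]
  set g : V →₁[(vectorCurrent μ F : Current Ω m).variation] Covector V m :=
    ((hT.integrable_testForm φ).indicator hA).toL1 (A.indicator ⇑φ) with hg
  -- test forms `ψ n` with `[ψ n] → g` in `L¹`
  have hgcl : g ∈ closure (range hT.toL1) := by
    rw [hT.denseRange_toL1.closure_range]; exact mem_univ g
  obtain ⟨u, hu_mem, hu_lim⟩ := mem_closure_iff_seq_limit.1 hgcl
  choose ψ hψ using hu_mem
  -- `T̄ (u n) → T̄ g`
  have h1 : Tendsto (fun n => hT.extend (u n)) atTop (𝓝 (hT.extend g)) :=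
    (hT.extend.continuous.tendsto g).comp hu_lim
  -- `T̄ (u n) = ∫ F (ψ n) dμ`
  have h2 : ∀ n, hT.extend (u n) = ∫ x, F x (ψ n x) ∂μ := fun n => by
    rw [← hψ n, hT.extend_toL1, vectorCurrent_apply hF]
  -- `∫ F (ψ n) dμ → ∫ F (1_A φ) dμ`
  have h3 : Tendsto (fun n => ∫ x, F x (ψ n x) ∂μ) atTop
      (𝓝 (∫ x, F x (A.indicator ⇑φ x) ∂μ)) := by
    rw [tendsto_iff_norm_sub_tendsto_zero]
    have hlim : Tendsto (fun n => ‖u n - g‖) atTop (𝓝 0) :=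
      tendsto_iff_norm_sub_tendsto_zero.1 hu_lim
    refine squeeze_zero (fun n => norm_nonneg _) (fun n => ?_) hlim
    have hnorm : ‖u n - g‖ =
        (∫⁻ x, ‖ψ n x - A.indicator ⇑φ x‖ₑ ∂(vectorCurrent μ F : Current Ω m).variation).toReal := by
      rw [Lp.norm_def, eLpNorm_one_eq_lintegral_enorm]
      congr 1
      refine lintegral_congr_ae ?_
      filter_upwards [Lp.coeFn_sub (u n) g, hT.coeFn_toL1 (ψ n),
        Integrable.coeFn_toL1 ((hT.integrable_testForm φ).indicator hA)] with x hx h1' h2'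
      rw [hx, Pi.sub_apply, ← hψ n, h1', hg, h2']
    have hfin : ∫⁻ x, ‖ψ n x - A.indicator ⇑φ x‖ₑ ∂(vectorCurrent μ F : Current Ω m).variation
        ≠ ⊤ := by
      intro htop
      have := hnorm
      rw [htop, ENNReal.toReal_top, norm_eq_zero, sub_eq_zero] at this
      -- `u n = g` forces the integral to be `0`, not `⊤`
      have h0 : ∫⁻ x, ‖ψ n x - A.indicator ⇑φ x‖ₑ ∂(vectorCurrent μ F : Current Ω m).variation
          = 0 := by
        rw [lintegral_eq_zero_iff' ?_]
        · filter_upwards [hT.coeFn_toL1 (ψ n),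
            Integrable.coeFn_toL1 ((hT.integrable_testForm φ).indicator hA)] with x h1' h2'
          have : (u n : V → Covector V m) x = (g : V → Covector V m) x := by rw [this]
          rw [← hψ n, h1', hg, h2'] at this
          simp [this]
        · exact ((ψ n).continuous.aestronglyMeasurable.sub
            ((hT.integrable_testForm φ).indicator hA).1).enorm
      exact ENNReal.zero_ne_top (h0 ▸ htop)
    have hb := norm_integral_apply_sub_le hF
      (TestFunction.integrable_bilin (covectorPairing V m) hF (ψ n))
      (integrable_apply_indicator hF hA φ) (fun x hx => by
        rw [image_eq_zero_of_notMem_tsupport fun h => hx ((ψ n).tsupport_subset h),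
          indicator_apply_eq_zero.2 fun _ =>
            image_eq_zero_of_notMem_tsupport fun h => hx (φ.tsupport_subset h), sub_zero]) hfin
    exact hb.trans (le_of_eq hnorm.symm)
  have h4 : Tendsto (fun n => hT.extend (u n)) atTop (𝓝 (∫ x, F x (A.indicator ⇑φ x) ∂μ)) := by
    simp_rw [h2]; exact h3
  have h5 := tendsto_nhds_unique h1 h4
  rw [h5]
  refine integral_congr_ae (Eventually.of_forall fun x => ?_)
  by_cases hx : x ∈ A
  · simp [indicator_of_mem hx]
  · simp [indicator_of_notMem hx]

/-- **`[W, θ, ξ] ⌞ A = [W ∩ A, θ, ξ]`** for admissible data and Borel `A`: restricting a current of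
integration cuts its carrier. [cite: Federer1969, 4.1.7] -/
theorem IsRectifiableData.restrictSet_eq {W : Set V} {θ : V → ℤ} {ξ : V → Fin m → V}
    (h : IsRectifiableData Ω m W θ ξ) {A : Set V} (hA : MeasurableSet A) :
    h.isRepresentable.restrictSet A hA = (currentOfIntegration (W ∩ A) θ ξ : Current Ω m) := by
  unfold currentOfIntegration
  rw [show ((μHE[m] : Measure V).restrict (W ∩ A)) = ((μHE[m] : Measure V).restrict W).restrict A
    by rw [Measure.restrict_restrict hA, inter_comm]]
  exact restrictSet_vectorCurrent h.2.2.2.1 hA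

/-- The cut data are admissible: `(W ∩ A, θ, ξ)` is admissible when `(W, θ, ξ)` is.
[cite: Federer1969, 4.1.28] -/
theorem IsRectifiableData.inter {W : Set V} {θ : V → ℤ} {ξ : V → Fin m → V}
    (h : IsRectifiableData Ω m W θ ξ) {A : Set V} (hA : MeasurableSet A) :
    IsRectifiableData Ω m (W ∩ A) θ ξ :=
  h.subset (h.1.inter hA) inter_subset_left

/-- **Restrictions of (locally) rectifiable currents to Borel sets are (locally) rectifiable**:
`[W, θ, ξ] ⌞ A = [W ∩ A, θ, ξ] ∈ 𝓡_m^{loc}(Ω)`. [cite: Federer1969, 4.1.28] -/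
theorem IsRectifiableData.isLocallyRectifiable_restrictSet {W : Set V} {θ : V → ℤ}
    {ξ : V → Fin m → V} (h : IsRectifiableData Ω m W θ ξ) {A : Set V} (hA : MeasurableSet A) :
    (h.isRepresentable.restrictSet A hA).IsLocallyRectifiable := by
  rw [h.restrictSet_eq hA]
  exact ⟨W ∩ A, θ, ξ, h.inter hA, rfl⟩

end RestrictIntegration

end Literature.Geometry.GeometricMeasureTheory
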